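import Summits.ResolutionOfSingularities.ResolutionOfSingularities.Theses.HilbertSamuelElimination
import Literature.AlgebraicGeometry.Resolution.HilbertSamuelLocal

/-!
# Disproof of `SigmaMaxModifications` — findings (cdisprove, cycle 1, 2026-08-17)

Crux `stmt-ResolutionOfSingularities-18506`, route `HilbertSamuelElimination`, decl
`Summit.ResolutionOfSingularities.ResolutionOfSingularities.Theses.HilbertSamuelElimination.SigmaMaxModifications`
(CJS LNM 2270 Def. 6.15 in modification form: for every reduced separated finite-type `X / k`,
`char k = p`, not regular, and every `N ≥ dim X`, a proper `π : X' → X`, `X'` reduced of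
dimension `≤ N`, iso over every open inside `X ∖ X_max` (ME1), dense preimage of `X ∖ X_max`,
`H^N_{X'}(x') ≤ H^N_X(π x')` pointwise, and no maximal value of `H^N_X` is a value of
`H^N_{X'}` (ME2)).

LANDED (gate-accepted, importable as
`Summits.ResolutionOfSingularities.ResolutionOfSingularities.Theorems.SigmaMaxModifications.Negative.LoadBearing`
/ `.Levels`; the copies below in this work file's own namespace are kept so that it reads standalone):
`Theorems/SigmaMaxModifications/Negative/LoadBearing.lean` (p147330: bridge, junk witnesses, (ME2),
load-bearing hypotheses) and `Theorems/SigmaMaxModifications/Negative/Levels.lean` (p147334: level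
dependence, level transfer, Spivakovsky–Hauser cycle), namespace
`Summit.ResolutionOfSingularities.ResolutionOfSingularities.Theorems.SigmaMaxModifications.Negative`.

VERDICT OF THIS CYCLE: **no kill**. The statement is the OPEN STEP of the Cossart–Jannsen–Saito
programme typed faithfully (Def. 2.28 / 2.35 / 6.15 read against pp. 33–37, 84–86 of the book):
a refutation needs a reduced finite-type `X` in characteristic `p` with NO Σ^max-modification
at some level `N ≥ dim X`; no such scheme is known or conjectured in print (CP2019 §1 only says
that no resolution by such modifications is KNOWN from dimension 3 on). What this file records,
as kernel-checked lemmas over the crux's own inline objects (`Scheme.hsFun`, `Scheme.hsValues`,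
`Scheme.hsMaxLocus` — the crux's `let H := …` is these by `rfl`, `sigmaMaxModifications_iff`):

* §0 `IsWitness` + `sigmaMaxModifications_iff` (`Iff.rfl`): the seven clauses, named.
* §1 DEGENERATE WITNESSES. `emptyWitness_clauses`: the EMPTY scheme satisfies every clause
  except (ME1) — for every `X` and `N` (so `withoutME1_trivial`: the crux with (ME1) deleted is
  trivially true, hypotheses or not); (ME1) fails for `∅` as soon as some non-empty open misses
  `X_max` (`not_ME1_empty_of_nonempty_open`). `identityWitness_clauses`: the IDENTITY satisfies
  every clause except (ME2), given only `Dense (X_max)ᶜ` (so `withoutME2_of_dense`); (ME2)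
  fails for `𝟙` as soon as `X_max ≠ ∅`. Moral for provers: the existence content is carried
  exactly by the pair (ME1) + (ME2); every other clause is bookkeeping that junk satisfies.
* §2 STRUCTURE OF (ME2). `ME2_iff_forall_lt` : given monotonicity, (ME2) ⟺ STRICT drop
  `H_{X'}(x') < H_X(π x')` at every point over `X_max` ("no near point survives"); and
  `hsFun_eq_of_ME1`: over the opens inside `X ∖ X_max` the function is unchanged (so the
  natural strengthening "strict drop everywhere" is absurd whenever `X ∖ X_max` has interior).
* §3 LOAD-BEARING HYPOTHESES. `IsReduced X` IS load-bearing
  (`no_witness_of_not_isReduced_opens`: (ME1) + `IsReduced X'` force every open inside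
  `X ∖ X_max` to be reduced; explicit victim: `Spec 𝔽_p[ε]/(ε²) ⊔ (three concurrent lines)` at
  `N = 1`, docstring). `dim X ≤ N` IS load-bearing (`no_witness_of_lt_dim_opens`: (ME1) +
  `dim X' ≤ N` force `dim U ≤ N` for opens inside `X ∖ X_max`; victim: any reduced singular
  curve at `N = 0`, where the truncated subtraction `N - ψ` makes `H = H^{(0)}` everywhere).
  `¬ IsRegular X` is NOT load-bearing (`exists_witness_of_isRegular`: for regular `X` of
  dimension `≤ N` every point is in `X_max`, so `∅` is a witness; `iff_without_notIsRegular`).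
  `IsSeparated` / `QuasiCompact` / `CharP` / `p.Prime`: no counterexample mechanism found
  (remarks in §3).
* §4 LEVEL DEPENDENCE. `hsFun_succ` (`H^{N+1} = (H^N)^{(1)}` once `ψ ≤ N`),
  `hsMaxLocus_succ_subset` (`X_max(N+1) ⊆ X_max(N)`): partial summation is monotone and
  injective but NOT an order embedding, and the inclusion is STRICT for the reduced curve
  `Spec 𝔽_p[t⁷,t⁹,t¹⁹] ⊔ Spec 𝔽_p[t⁷,t⁸,t¹⁸]` (tangent-cone Hilbert functions
  `(1,3,5,5,6,7,7,…)` and `(1,3,5,6,6,6,7,…)`: incomparable, partial sums comparable; local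
  script `compute/semigroup_hilbert.py`, 221 such pairs among 265 embedding-dimension-3
  semigroups of multiplicity ≤ 8). So the crux's `∀ N ≥ dim X` is a genuine extra quantifier
  ((ME1) gets STRONGER with `N`, (ME2)+monotonicity weaker), and CJS Rem. 2.29 (a) "the choice of
  `N` does not matter" is false for `X_max` read literally. Transfer lemmas `hsStratum_succ_psum`,
  `psum_not_mem_hsValues_succ`, `maximal_of_maximal_psum_succ`: ν-wise statements (Def. 6.14)
  move UP in level, glued Σ^max statements (Def. 6.15; the tree fact
  `CossartJannsenSaito2020_sigmaMaxElimination`, pinned at `N = 2`) do NOT — for `dim X ≤ 2` at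
  levels `N ≠ 2` the crux is not literally an instance of that fact (note for the lead's stubs).
* §5 WHAT A COUNTEREXAMPLE MUST BE (`not_sigmaMaxModifications_iff`), and why none of the
  catalogued specimens is one (they test the programme's STRATEGY, Rem. 6.29, not existence).
* §6 NATURAL STRENGTHENINGS. `spivakovsky_hauser_cycle`: "every permissible blow-up sequence inside
  `X_max` terminates" is FALSE in print in all characteristics (Spivakovsky 1989 / Hauser 1998 Ex. 2:
  `x³ + yz²w⁴ + yz⁴w²`, a 2-cycle of permissible axis blow-ups; chart identities by `ring`); informal: "π finite" is false from
  dimension 2 (normal surface singularities); "one permissible blow-up" is false (tacnode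
  `y² = x⁴`: the near point keeps `(1,2,2,…)`); "X' regular" is resolution iso off `X_max`,
  unavailable whenever `X_max ∩ closure(Sing X ∖ X_max) ≠ ∅` (ideator k2's corridor N2).
* §7 TARGETS: none registered yet (PICKED.md names `stub_nuEliminationsExist` as the open core;
  the ν-by-ν glue `stub_sigmaMaxModification_of_nuModifications` is sound on paper, see §7).

Everything conclusive here is `sorry`-free; nothing concludes a Theses decl positively.
-/

noncomputable section

-- single-problem summit: the doubled namespace component `ResolutionOfSingularities` is forced
set_option linter.dupNamespace false

open CategoryTheory AlgebraicGeometry TopologicalSpace Topology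
open Literature.RingTheory.HilbertSamuel Literature.AlgebraicGeometry.Resolution

namespace Summit.ResolutionOfSingularities.ResolutionOfSingularities.Cruxes.SigmaMaxModifications.Disproof

open Summit.ResolutionOfSingularities.ResolutionOfSingularities.Theses.HilbertSamuelElimination
  (SigmaMaxModifications)

/-! ## §0 The clauses, named -/

/-- The seven clauses of the crux's conclusion for a candidate `π : X' → X` at level `N`, over
the tree's `Scheme.hsFun / hsValues / hsMaxLocus` (CJS Def. 2.28 / 2.35), which ARE the crux's
inline `H`, `Set.range (H X)` and `{x | Maximal (· ∈ Set.range (H X)) (H X x)}` by `rfl`. -/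
def IsWitness (N : ℕ) (X X' : Scheme.{0}) (π : X' ⟶ X) : Prop :=
  IsProper π ∧ IsReduced X' ∧ topologicalKrullDim X' ≤ (N : WithBot ℕ∞) ∧
    (∀ U : X.Opens, (U : Set X) ⊆ (Scheme.hsMaxLocus X N)ᶜ → IsIso (π ∣_ U)) ∧
    Dense ((fun x' => π.base x') ⁻¹' (Scheme.hsMaxLocus X N)ᶜ) ∧
    (∀ x' : X', Scheme.hsFun X' N x' ≤ Scheme.hsFun X N (π.base x')) ∧
    ∀ ν : ℕ → ℕ, Maximal (· ∈ Scheme.hsValues X N) ν → ν ∉ Scheme.hsValues X' N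

/-- The crux, clause-bundled: a definitional unfolding (`Iff.rfl`), which certifies that the
inline `H` of the route file is `Scheme.hsFun` and its Hilbert–Samuel locus is `Scheme.hsMaxLocus`. -/
theorem sigmaMaxModifications_iff :
    SigmaMaxModifications ↔
      ∀ p : ℕ, p.Prime → ∀ (k : Type) [Field k] [CharP k p] (X : Scheme.{0})
        (f : X ⟶ Spec (.of k)), IsSeparated f → LocallyOfFiniteType f → QuasiCompact f →
        IsReduced X → ¬ Scheme.IsRegular X →
        ∀ N : ℕ, topologicalKrullDim X ≤ (N : WithBot ℕ∞) →
          ∃ (X' : Scheme.{0}) (π : X' ⟶ X), IsWitness N X X' π :=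
  Iff.rfl

/-! ## §1 Degenerate witnesses: which clause excludes which junk -/

/-- `dim ∅ = ⊥`. [folklore] -/
theorem topologicalKrullDim_empty : topologicalKrullDim (∅ : Scheme.{0}) = ⊥ := by
  haveI : IsEmpty (IrreducibleCloseds (∅ : Scheme.{0})) :=
    ⟨fun Z => Z.isIrreducible.nonempty.elim fun x _ => isEmptyElim x⟩
  exact Order.krullDim_eq_bot

/-- `∅` is reduced. [folklore] -/
theorem isReduced_empty : IsReduced (∅ : Scheme.{0}) :=
  ⟨fun _ => ⟨fun x _ => Subsingleton.elim x 0⟩⟩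

/-- **The EMPTY scheme satisfies every clause of the crux except (ME1)**, for every `X` and every
level `N` (no hypothesis on `X` at all): `∅ → X` is proper, `∅` is reduced of dimension `⊥`, the
preimage of anything is dense in `∅`, monotonicity is vacuous, and NO function is a value on `∅`,
so (ME2) holds. [folklore] -/
theorem emptyWitness_clauses (N : ℕ) (X : Scheme.{0}) :
    IsProper (Scheme.emptyTo X) ∧ IsReduced (∅ : Scheme.{0}) ∧
      topologicalKrullDim (∅ : Scheme.{0}) ≤ (N : WithBot ℕ∞) ∧
      Dense ((fun x' => (Scheme.emptyTo X).base x') ⁻¹' (Scheme.hsMaxLocus X N)ᶜ) ∧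
      (∀ x' : (∅ : Scheme.{0}), Scheme.hsFun _ N x' ≤ Scheme.hsFun X N ((Scheme.emptyTo X).base x')) ∧
      ∀ ν : ℕ → ℕ, Maximal (· ∈ Scheme.hsValues X N) ν → ν ∉ Scheme.hsValues (∅ : Scheme.{0}) N := by
  refine ⟨inferInstance, isReduced_empty, by rw [topologicalKrullDim_empty]; exact bot_le,
    fun x => isEmptyElim x, fun x => isEmptyElim x, ?_⟩
  rintro ν - ⟨x, -⟩
  exact isEmptyElim x

/-- **(ME1) is the ONLY clause that excludes the empty witness**: for `π : ∅ → X`, the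
restriction over a NON-EMPTY open `U` is not an isomorphism. For a reduced non-regular `X` of
finite type such a `U` inside `X ∖ X_max` exists (the regular locus is a dense open carrying the
minimal value `Φ^{(N)}`, CJS Lemma 2.31), which is what kills `∅` in the crux itself.
[folklore] -/
theorem not_isIso_emptyTo_restrict {X : Scheme.{0}} (U : X.Opens) (hU : (U : Set X).Nonempty) :
    ¬ IsIso (Scheme.emptyTo X ∣_ U) := by
  intro h
  obtain ⟨x, hx⟩ := hU
  have hsurj := (inferInstance : Surjective (Scheme.emptyTo X ∣_ U)).1
  obtain ⟨y, -⟩ := hsurj ⟨x, hx⟩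
  exact isEmptyElim (show (∅ : Scheme.{0}) from ((Scheme.emptyTo X) ⁻¹ᵁ U).ι.base y)

/-- **Without (ME1) the crux is TRIVIALLY TRUE** (the empty scheme witnesses it, for every `X`,
regardless of every hypothesis). So any proof must produce its `X'` from (ME1), and any
disproof must use (ME1). [folklore] -/
theorem withoutME1_trivial (X : Scheme.{0}) (N : ℕ) :
    ∃ (X' : Scheme.{0}) (π : X' ⟶ X), IsProper π ∧ IsReduced X' ∧
      topologicalKrullDim X' ≤ (N : WithBot ℕ∞) ∧
      Dense ((fun x' => π.base x') ⁻¹' (Scheme.hsMaxLocus X N)ᶜ) ∧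
      (∀ x' : X', Scheme.hsFun X' N x' ≤ Scheme.hsFun X N (π.base x')) ∧
      ∀ ν : ℕ → ℕ, Maximal (· ∈ Scheme.hsValues X N) ν → ν ∉ Scheme.hsValues X' N :=
  ⟨∅, Scheme.emptyTo X, emptyWitness_clauses N X⟩

/-- **The IDENTITY satisfies every clause except (ME2)**, given only that `X ∖ X_max` is dense
(true for reduced non-regular excellent `X`: support item `MaxLocusNowhereDense`, CJS Rem. 6.13
(b)–(c)) and the hypotheses `IsReduced X`, `dim X ≤ N` of the crux. [folklore] -/
theorem identityWitness_clauses (N : ℕ) (X : Scheme.{0}) [IsReduced X]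
    (hdim : topologicalKrullDim X ≤ (N : WithBot ℕ∞)) (hdense : Dense (Scheme.hsMaxLocus X N)ᶜ) :
    IsProper (𝟙 X) ∧ IsReduced X ∧ topologicalKrullDim X ≤ (N : WithBot ℕ∞) ∧
      (∀ U : X.Opens, (U : Set X) ⊆ (Scheme.hsMaxLocus X N)ᶜ → IsIso (𝟙 X ∣_ U)) ∧
      Dense ((fun x' => (𝟙 X : X ⟶ X).base x') ⁻¹' (Scheme.hsMaxLocus X N)ᶜ) ∧
      ∀ x' : X, Scheme.hsFun X N x' ≤ Scheme.hsFun X N ((𝟙 X : X ⟶ X).base x') :=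
  ⟨inferInstance, inferInstance, hdim, fun _ _ => inferInstance, hdense, fun _ => le_rfl⟩

/-- **(ME2) is the ONLY clause the identity fails**, and it fails it exactly when `X_max ≠ ∅`:
a maximal VALUE is in particular a value. For a reduced non-regular finite-type `X`, `Σ_X` is
finite and non-empty, so `X_max ≠ ∅`. [folklore] -/
theorem not_ME2_identity_iff (N : ℕ) (X : Scheme.{0}) :
    (∀ ν : ℕ → ℕ, Maximal (· ∈ Scheme.hsValues X N) ν → ν ∉ Scheme.hsValues X N) ↔
      Scheme.hsMaxLocus X N = ∅ := by
  constructor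
  · intro h
    ext x
    simp only [Scheme.mem_hsMaxLocus_iff, Set.mem_empty_iff_false, iff_false]
    exact fun hx => h _ hx hx.1
  · intro h ν hν hνv
    obtain ⟨x, hx⟩ := hνv
    have : x ∈ Scheme.hsMaxLocus X N := by
      rw [Scheme.mem_hsMaxLocus_iff]
      show Maximal (· ∈ Scheme.hsValues X N) (Scheme.hsFun X N x)
      rw [hx]; exact hν
    rw [h] at this
    exact this

/-- **Without (ME2) the crux reduces to the density of `X ∖ X_max`** (identity witness). So the
existence content of the crux is carried exactly by the pair (ME1) + (ME2). [folklore] -/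
theorem withoutME2_of_dense (N : ℕ) (X : Scheme.{0}) [IsReduced X]
    (hdim : topologicalKrullDim X ≤ (N : WithBot ℕ∞)) (hdense : Dense (Scheme.hsMaxLocus X N)ᶜ) :
    ∃ (X' : Scheme.{0}) (π : X' ⟶ X), IsProper π ∧ IsReduced X' ∧
      topologicalKrullDim X' ≤ (N : WithBot ℕ∞) ∧
      (∀ U : X.Opens, (U : Set X) ⊆ (Scheme.hsMaxLocus X N)ᶜ → IsIso (π ∣_ U)) ∧
      Dense ((fun x' => π.base x') ⁻¹' (Scheme.hsMaxLocus X N)ᶜ) ∧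
      ∀ x' : X', Scheme.hsFun X' N x' ≤ Scheme.hsFun X N (π.base x') :=
  ⟨X, 𝟙 X, identityWitness_clauses N X hdim hdense⟩

/-! ## §2 The structure of (ME2): strict drop over `X_max`, equality off it -/

/-- **(ME2) ⟺ "no near point survives"**: given the monotonicity clause, "no maximal value of
`H_X` is a value of `H_{X'}`" is equivalent to the STRICT inequality `H_{X'}(x') < H_X(π x')` at
every point `x'` lying over `X_max` (a maximal `ν' ≤ ν` with `ν` a value forces `ν = ν'`). This is
CJS's remark after Def. 6.15 ("(ME1) and (ME2) imply: for each `μ ∈ Σ_{X'}` there exists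
`ν ∈ Σ_X^max` with `μ < ν`" is the same computation). Pure order theory. [cite: CossartJannsenSaito2020, Def. 6.15] -/
theorem ME2_iff_forall_lt {N : ℕ} {X X' : Scheme.{0}} (π : X' ⟶ X)
    (hmono : ∀ x' : X', Scheme.hsFun X' N x' ≤ Scheme.hsFun X N (π.base x')) :
    (∀ ν : ℕ → ℕ, Maximal (· ∈ Scheme.hsValues X N) ν → ν ∉ Scheme.hsValues X' N) ↔
      ∀ x' : X', π.base x' ∈ Scheme.hsMaxLocus X N →
        Scheme.hsFun X' N x' < Scheme.hsFun X N (π.base x') := by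
  constructor
  · intro h x' hx'
    refine lt_of_le_of_ne (hmono x') fun heq => ?_
    exact h _ (by rw [Scheme.mem_hsMaxLocus_iff] at hx'; rw [← heq] at hx'; exact hx') ⟨x', rfl⟩
  · rintro h ν hν ⟨x', rfl⟩
    -- `ν = H_{X'}(x') ≤ H_X(π x')`, a value; maximality forces equality, so `π x' ∈ X_max`
    have hle := hmono x'
    have hge : Scheme.hsFun X N (π.base x') ≤ Scheme.hsFun X' N x' := hν.2 ⟨π.base x', rfl⟩ hle
    have heq : Scheme.hsFun X' N x' = Scheme.hsFun X N (π.base x') := le_antisymm hle hge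
    have hmax : π.base x' ∈ Scheme.hsMaxLocus X N := by
      rw [Scheme.mem_hsMaxLocus_iff, ← heq]; exact hν
    exact (h x' hmax).ne heq

/-- **Over the opens inside `X ∖ X_max` nothing changes**: (ME1) makes `π` an isomorphism over
`U`, hence on stalks, and `H^N` depends only on the local ring (tree
`Scheme.hsFun_eq_of_isOpenImmersion`). So monotonicity is automatic there, and the natural
strengthening "strict drop at EVERY point of `X'`" is absurd as soon as `X ∖ X_max` has a
non-empty open inside it (always, for reduced non-regular `X` of finite type).
[cite: CossartJannsenSaito2020, Def. 2.28] -/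
theorem hsFun_eq_of_ME1 {N : ℕ} {X X' : Scheme.{0}} [IsLocallyNoetherian X]
    [IsLocallyNoetherian X'] (π : X' ⟶ X) (U : X.Opens) [IsIso (π ∣_ U)] (x' : X')
    (hx' : π.base x' ∈ U) : Scheme.hsFun X' N x' = Scheme.hsFun X N (π.base x') := by
  -- the composite `π⁻¹(U) ≅ U ↪ X` is an open immersion, and it is `ι ≫ π`
  have hfac : (π ⁻¹ᵁ U).ι ≫ π = (π ∣_ U) ≫ U.ι := (morphismRestrict_ι π U).symm
  let y : ↥(π ⁻¹ᵁ U) := ⟨x', hx'⟩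
  have hy : (π ⁻¹ᵁ U).ι.base y = x' := rfl
  have h1 : Scheme.hsFun (↑(π ⁻¹ᵁ U)) N y = Scheme.hsFun X N (((π ∣_ U) ≫ U.ι).base y) :=
    Scheme.hsFun_eq_of_isOpenImmersion ((π ∣_ U) ≫ U.ι) N y
  have h2 : Scheme.hsFun (↑(π ⁻¹ᵁ U)) N y = Scheme.hsFun X' N ((π ⁻¹ᵁ U).ι.base y) :=
    Scheme.hsFun_eq_of_isOpenImmersion (π ⁻¹ᵁ U).ι N y
  rw [← hy, ← h2, h1, ← Scheme.Hom.comp_apply, ← hfac, Scheme.Hom.comp_apply]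

/-! ## §3 Load-bearing hypotheses

For each hypothesis `H` of the crux: is "crux without `H`" false (then ANY proof must use `H`),
or is `H` redundant? The two genuinely load-bearing ones (`IsReduced X`, `dim X ≤ N`) are
load-bearing through (ME1): the opens inside `X ∖ X_max` are carried ISOMORPHICALLY into `X'`,
so they inherit reducedness and the dimension bound from the conclusion. -/

/-- (ME1) + `IsReduced X'` ⟹ every open of `X` inside `X ∖ X_max` is reduced. [folklore] -/
theorem isReduced_opens_of_ME1 {X X' : Scheme.{0}} (π : X' ⟶ X) [IsReduced X']
    (U : X.Opens) [IsIso (π ∣_ U)] : IsReduced (U : Scheme.{0}) := by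
  haveI : IsReduced (↑(π ⁻¹ᵁ U) : Scheme.{0}) := isReduced_of_isOpenImmersion (π ⁻¹ᵁ U).ι
  exact isReduced_of_isOpenImmersion (inv (π ∣_ U))

/-- **`IsReduced X` is LOAD-BEARING.** With it dropped (everything else, including
`IsReduced X'`, kept) the statement fails at every `X` having a NON-REDUCED open inside
`X ∖ X_max`: (ME1) would make that open an open subscheme of the reduced `X'`. Smallest victim
(dimension `0`, any `p`, any `N ≥ 0`): `X = Spec 𝔽_p[ε]/(ε²) ⊔ Spec 𝔽_p[ε]/(ε³)`, values
`(1,1,0,0,…)^{(N)} < (1,1,1,0,…)^{(N)}`, so `X_max` is the second point and the first point is a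
non-reduced clopen inside `X ∖ X_max`; in dimension `1`: `Spec 𝔽_p[ε]/(ε²) ⊔ V(xy(x+y)) ⊂ 𝔸²`
at `N = 1` (`(1,2,2,…) < (1,3,3,…)`). (CJS Rem. 6.13 (d) is the authors' own warning that the
non-reduced case does not reduce to `X_max`-supported blow-ups.) The abstract form PROVED here is
what every such victim instantiates. [cite: CossartJannsenSaito2020, Rem. 6.13 (d)] -/
theorem no_witness_of_not_isReduced_opens {N : ℕ} {X : Scheme.{0}} (U : X.Opens)
    (hU : (U : Set X) ⊆ (Scheme.hsMaxLocus X N)ᶜ) (hred : ¬ IsReduced (U : Scheme.{0})) :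
    ¬ ∃ (X' : Scheme.{0}) (π : X' ⟶ X), IsWitness N X X' π := by
  rintro ⟨X', π, -, hX', -, hME1, -⟩
  haveI := hME1 U hU
  exact hred (isReduced_opens_of_ME1 π U)

/-- (ME1) + `dim X' ≤ N` ⟹ every open of `X` inside `X ∖ X_max` has dimension `≤ N`.
[folklore] -/
theorem topologicalKrullDim_opens_le_of_ME1 {N : ℕ} {X X' : Scheme.{0}} (π : X' ⟶ X)
    (hdim : topologicalKrullDim X' ≤ (N : WithBot ℕ∞)) (U : X.Opens) [IsIso (π ∣_ U)] :
    topologicalKrullDim (U : Scheme.{0}) ≤ (N : WithBot ℕ∞) := by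
  have h1 : topologicalKrullDim (↑(π ⁻¹ᵁ U) : Scheme.{0}) ≤ topologicalKrullDim X' :=
    (π ⁻¹ᵁ U).ι.isOpenEmbedding.isEmbedding.isInducing.topologicalKrullDim_le
  have h2 : topologicalKrullDim (↑(π ⁻¹ᵁ U) : Scheme.{0}) = topologicalKrullDim (U : Scheme.{0}) :=
    IsHomeomorph.topologicalKrullDim_eq _ (Scheme.homeoOfIso (asIso (π ∣_ U))).isHomeomorph
  rw [← h2]
  exact h1.trans hdim

/-- **`dim X ≤ N` is LOAD-BEARING.** With it dropped, the truncated subtraction `N - ψ_X(x)`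
silently re-levels the function, and at `N = 0` the clause `dim X' ≤ N = 0` contradicts (ME1)
over any positive-dimensional open inside `X ∖ X_max`. Victim (any `p`): the node
`X = Spec 𝔽_p[x,y]/(xy)` at `N = 0`, where `H^0 = H^{(0)}` everywhere: generic points
`(1,0,0,…)`, regular closed points `(1,1,1,…)`, the node `(1,2,2,…)`; `X_max = {node}`, and
`D(x) ≅ Spec 𝔽_p[x,x⁻¹]` is a one-dimensional open inside `X ∖ X_max` (birth attack, refuter
2026-08-17T05:11Z). The abstract form PROVED here is what the victim instantiates. [folklore] -/
theorem no_witness_of_lt_dim_opens {N : ℕ} {X : Scheme.{0}} (U : X.Opens)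
    (hU : (U : Set X) ⊆ (Scheme.hsMaxLocus X N)ᶜ)
    (hdimU : ¬ topologicalKrullDim (U : Scheme.{0}) ≤ (N : WithBot ℕ∞)) :
    ¬ ∃ (X' : Scheme.{0}) (π : X' ⟶ X), IsWitness N X X' π := by
  rintro ⟨X', π, -, -, hdim, hME1, -⟩
  haveI := hME1 U hU
  exact hdimU (topologicalKrullDim_opens_le_of_ME1 π hdim U)

/-- `dim 𝒪_{X,x} ≤ dim X` (Stacks 02IZ: `dim 𝒪_{X,x}` is the coheight of `x` in the
specialisation order). [cite: StacksProject, Tag 02IZ] -/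
theorem ringKrullDim_stalk_le (X : Scheme.{0}) (x : X) :
    ringKrullDim (X.presheaf.stalk x) ≤ topologicalKrullDim X := by
  rw [AlgebraicGeometry.ringKrullDim_stalk_eq_coheight, topologicalKrullDim,
    Order.krullDim_eq_of_orderIso (irreducibleSetEquivPoints (α := X))]
  exact Order.coheight_le_krullDim x

/-- On a REGULAR scheme of dimension `≤ N` every point is in `X_max` (all values are `Φ^{(N)}`,
CJS Rem. 2.32), so `X ∖ X_max = ∅`. [cite: CossartJannsenSaito2020, Rem. 2.32] -/
theorem hsMaxLocus_eq_univ_of_isRegular {N : ℕ} {X : Scheme.{0}} (hreg : Scheme.IsRegular X)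
    (hdim : topologicalKrullDim X ≤ (N : WithBot ℕ∞)) : Scheme.hsMaxLocus X N = Set.univ := by
  have hd : ∀ x : X, ∃ d : ℕ, ringKrullDim (X.presheaf.stalk x) = d ∧ d ≤ N := by
    intro x
    haveI : IsRegularLocalRing (X.presheaf.stalk x) := hreg x
    have hle : ringKrullDim (X.presheaf.stalk x) ≤ (N : WithBot ℕ∞) :=
      (ringKrullDim_stalk_le X x).trans hdim
    obtain ⟨d, hd⟩ := exists_nat_eq_of_ne_bot_of_ne_top
      (ne_bot_of_le_ne_bot WithBot.zero_ne_bot ringKrullDim_nonneg_of_nontrivial)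
      (ringKrullDim_ne_top (R := X.presheaf.stalk x))
    refine ⟨d, hd, ?_⟩
    rw [hd] at hle
    exact_mod_cast hle
  have hsub := Scheme.hsValues_subset_of_isRegular hreg hd
  ext x
  simp only [Set.mem_univ, iff_true, Scheme.mem_hsMaxLocus_iff]
  refine ⟨⟨x, rfl⟩, ?_⟩
  intro μ hμ _
  have h1 : μ = iterPSum N Phi := hsub hμ
  have h2 : Scheme.hsFun X N x = iterPSum N Phi := hsub ⟨x, rfl⟩
  rw [h1, h2]

/-- **`¬ IsRegular X` is NOT load-bearing**: for a regular `X` of dimension `≤ N` the empty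
scheme IS a witness ((ME1) is vacuous because `X ∖ X_max = ∅`, `hsMaxLocus_eq_univ_of_isRegular`;
the other clauses by `emptyWitness_clauses`). [folklore] -/
theorem exists_witness_of_isRegular {N : ℕ} {X : Scheme.{0}} (hreg : Scheme.IsRegular X)
    (hdim : topologicalKrullDim X ≤ (N : WithBot ℕ∞)) :
    ∃ (X' : Scheme.{0}) (π : X' ⟶ X), IsWitness N X X' π := by
  obtain ⟨h1, h2, h3, h5, h6, h7⟩ := emptyWitness_clauses N X
  refine ⟨∅, Scheme.emptyTo X, h1, h2, h3, ?_, h5, h6, h7⟩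
  intro U hU
  rw [hsMaxLocus_eq_univ_of_isRegular hreg hdim, Set.compl_univ] at hU
  haveI : IsEmpty (U : Scheme.{0}) := ⟨fun u => hU u.2⟩
  infer_instance

/-- Hence **the crux is EQUIVALENT to the same statement with `¬ IsRegular X` deleted** (the
planner may drop the hypothesis; provers gain nothing from it). [folklore] -/
theorem iff_without_notIsRegular :
    SigmaMaxModifications ↔
      ∀ p : ℕ, p.Prime → ∀ (k : Type) [Field k] [CharP k p] (X : Scheme.{0})
        (f : X ⟶ Spec (.of k)), IsSeparated f → LocallyOfFiniteType f → QuasiCompact f →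
        IsReduced X → ∀ N : ℕ, topologicalKrullDim X ≤ (N : WithBot ℕ∞) →
          ∃ (X' : Scheme.{0}) (π : X' ⟶ X), IsWitness N X X' π := by
  rw [sigmaMaxModifications_iff]
  constructor
  · intro h p hp k _ _ X f hs hl hq hr N hN
    by_cases hreg : Scheme.IsRegular X
    · exact exists_witness_of_isRegular hreg hN
    · exact h p hp k X f hs hl hq hr hreg N hN
  · intro h p hp k _ _ X f hs hl hq hr _ N hN
    exact h p hp k X f hs hl hq hr N hN

/-! ### Remarks on the remaining hypotheses (no counterexample mechanism found)

* `LocallyOfFiniteType f` — the printed theory is for EXCELLENT schemes (CJS Cor. 6.18); every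
  clause of the crux makes sense there and the natural generalisation is believed exactly as
  much as the crux. Without ANY finiteness the junk values of `H` (`hilbertFun` of a
  non-Noetherian stalk, `minimalPrimesCodim = 0` by `sInf ∅`) can make `Σ_X` infinite with no
  maximal element, and then the crux holds TRIVIALLY (`X_max = ∅`, identity witness,
  `not_ME2_identity_iff`) — dropping it does not produce falsity cheaply.
* `QuasiCompact f` — same remark: `X = ⊔_{m ≥ 2} (m concurrent lines in 𝔸^m)` has the CHAIN of
  values `(1,m,m,…)`, no maximal one, `X_max = ∅`, identity witness. Quasi-compactness is what
  makes `Σ_X` finite (CJS Lemma 2.36 (b)), i.e. what makes the crux non-vacuous, not what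
  makes it true.
* `IsSeparated f` — local on `X` near `X_max`; no mechanism.
* `p.Prime` / `CharP k p` — deleting them admits characteristic `0`, where Σ^max-eliminations
  exist (Hironaka 1964 / Bierstone–Milman 1997: centres inside the maximal Hilbert–Samuel
  stratum); not a source of counterexamples.
-/

/-! ## §4 Level dependence: `X_max` shrinks as `N` grows -/

/-- `ψ_X(x) ≤ N` once `dim X ≤ N` (`ψ ≤ dim 𝒪_{X,x} ≤ dim X`). [cite: CossartJannsenSaito2020, Def. 2.28] -/
theorem hsPsi_le_of_dim_le {X : Scheme.{0}} [IsLocallyNoetherian X] {N : ℕ}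
    (hdim : topologicalKrullDim X ≤ (N : WithBot ℕ∞)) (x : X) : Scheme.hsPsi X x ≤ N := by
  have h1 : (Scheme.hsPsi X x : WithBot ℕ∞) ≤ ringKrullDim (X.presheaf.stalk x) :=
    minimalPrimesCodim_le_ringKrullDim (X.presheaf.stalk x)
  have h2 := (h1.trans (ringKrullDim_stalk_le X x)).trans hdim
  exact_mod_cast h2

/-- **`H^{N+1}_X(x) = (H^N_X(x))^{(1)}`** as soon as `ψ_X(x) ≤ N` (below that the truncated
subtraction freezes the level). [cite: CossartJannsenSaito2020, Rem. 2.29 (b)] -/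
theorem hsFun_succ {X : Scheme.{0}} {N : ℕ} (x : X) (hψ : Scheme.hsPsi X x ≤ N) :
    Scheme.hsFun X (N + 1) x = psum (Scheme.hsFun X N x) := by
  rw [Scheme.hsFun_def, Scheme.hsFun_def, Nat.succ_sub hψ, hilbertSamuelFun_succ]

/-- **`X_max(N+1) ⊆ X_max(N)`**: partial summation `ν ↦ ν^{(1)}` is monotone and injective, so a
point maximal at level `N + 1` is maximal at level `N`. It is NOT an order embedding (CJS Rem.
2.29 (b): "the converse does not hold in general"), and the inclusion can be STRICT for reduced
curves: the monomial curves `C₁ = Spec 𝔽_p[t⁷,t⁹,t¹⁹]`, `C₂ = Spec 𝔽_p[t⁷,t⁸,t¹⁸]` have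
tangent-cone Hilbert functions `h₁ = (1,3,5,5,6,7,7,…)`, `h₂ = (1,3,5,6,6,6,7,…)` at their
cusps (`h(n) = #(nM ∖ (n+1)M)` for the semigroup ideal `M`; local script
`compute/semigroup_hilbert.py`), INCOMPARABLE (`h₁(3) < h₂(3)`, `h₁(5) > h₂(5)`) while
`h₁^{(1)} = (1,4,9,14,20,27,34,…) ≤ h₂^{(1)} = (1,4,9,15,21,27,34,…)`. For `X = C₁ ⊔ C₂`
(`dim X = 1`, `ψ = 1` at closed points): `X_max(1) = {0₁, 0₂}` but `X_max(2) = {0₂}` — at level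
`2` the crux demands a `π` that is an isomorphism over all of `C₁`, at level `1` one that improves
both cusps. So `∀ N ≥ dim X` is a genuine extra quantifier of the crux ((ME1) strengthens with
`N`; monotonicity and (ME2) weaken), and Rem. 2.29 (a) "the choice of `N` does not matter" is
false for `X_max` read literally (221 such pairs among the 265 embedding-dimension-3 numerical
semigroups of multiplicity `≤ 8`). [cite: CossartJannsenSaito2020, Rem. 2.29] -/
theorem hsMaxLocus_succ_subset {X : Scheme.{0}} [IsLocallyNoetherian X] {N : ℕ}
    (hdim : topologicalKrullDim X ≤ (N : WithBot ℕ∞)) :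
    Scheme.hsMaxLocus X (N + 1) ⊆ Scheme.hsMaxLocus X N := by
  intro x hx
  rw [Scheme.mem_hsMaxLocus_iff] at hx ⊢
  refine ⟨⟨x, rfl⟩, ?_⟩
  rintro _ ⟨y, rfl⟩ hxy
  have h1 : Scheme.hsFun X (N + 1) x ≤ Scheme.hsFun X (N + 1) y := by
    rw [hsFun_succ x (hsPsi_le_of_dim_le hdim x), hsFun_succ y (hsPsi_le_of_dim_le hdim y)]
    exact psum_mono hxy
  have h2 : Scheme.hsFun X (N + 1) y ≤ Scheme.hsFun X (N + 1) x := hx.2 ⟨y, rfl⟩ h1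
  have heq : Scheme.hsFun X (N + 1) y = Scheme.hsFun X (N + 1) x := le_antisymm h2 h1
  rw [hsFun_succ x (hsPsi_le_of_dim_le hdim x), hsFun_succ y (hsPsi_le_of_dim_le hdim y)] at heq
  rw [psum_injective heq]

/-- Consequently the complement GROWS with the level: (ME1) at level `N + 1` asks for an
isomorphism over (every open inside) a larger set. [folklore] -/
theorem compl_hsMaxLocus_subset_succ {X : Scheme.{0}} [IsLocallyNoetherian X] {N : ℕ}
    (hdim : topologicalKrullDim X ≤ (N : WithBot ℕ∞)) :
    (Scheme.hsMaxLocus X N)ᶜ ⊆ (Scheme.hsMaxLocus X (N + 1))ᶜ :=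
  Set.compl_subset_compl.mpr (hsMaxLocus_succ_subset hdim)

/-- … while monotonicity gets WEAKER with the level: `H^N_{X'}(x') ≤ H^N_X(x)` implies the same at
level `N + 1` (but not conversely). [folklore] -/
theorem hsFun_succ_le_of_le {X X' : Scheme.{0}} {N : ℕ} {x : X} {x' : X'}
    (hψ : Scheme.hsPsi X x ≤ N) (hψ' : Scheme.hsPsi X' x' ≤ N)
    (h : Scheme.hsFun X' N x' ≤ Scheme.hsFun X N x) :
    Scheme.hsFun X' (N + 1) x' ≤ Scheme.hsFun X (N + 1) x := by
  rw [hsFun_succ x hψ, hsFun_succ x' hψ']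
  exact psum_mono h

/-- **Strata transfer up one level**: `X(ν)` at level `N` is `X(ν^{(1)})` at level `N + 1`
(`dim X ≤ N`). So "`π` is an isomorphism off `X(ν)`" is level-independent in this sense.
[cite: CossartJannsenSaito2020, Rem. 2.29 (b)] -/
theorem hsStratum_succ_psum {X : Scheme.{0}} [IsLocallyNoetherian X] {N : ℕ}
    (hdim : topologicalKrullDim X ≤ (N : WithBot ℕ∞)) (ν : ℕ → ℕ) :
    Scheme.hsStratum X (N + 1) (psum ν) = Scheme.hsStratum X N ν := by
  ext x
  simp only [Scheme.mem_hsStratum_iff]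
  rw [hsFun_succ x (hsPsi_le_of_dim_le hdim x)]
  exact psum_injective.eq_iff

/-- **Killing a value transfers up one level**: `ν ∉ Σ_{X'}(N)` implies `ν^{(1)} ∉ Σ_{X'}(N+1)`
(`dim X' ≤ N`). [cite: CossartJannsenSaito2020, Rem. 2.29 (b)] -/
theorem psum_not_mem_hsValues_succ {X : Scheme.{0}} [IsLocallyNoetherian X] {N : ℕ}
    (hdim : topologicalKrullDim X ≤ (N : WithBot ℕ∞)) {ν : ℕ → ℕ}
    (h : ν ∉ Scheme.hsValues X N) : psum ν ∉ Scheme.hsValues X (N + 1) := by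
  rintro ⟨x, hx⟩
  rw [hsFun_succ x (hsPsi_le_of_dim_le hdim x)] at hx
  exact h ⟨x, psum_injective hx⟩

/-- **Maximal values transfer DOWN one level**: if `ν^{(1)}` is a maximal value at level `N + 1`
then `ν` is a maximal value at level `N` (`dim X ≤ N`); the converse fails (§4 example). Hence
`Σ^max(N+1) = {ν^{(1)} : ν ∈ S}` for a SUBSET `S ⊆ Σ^max(N)`, and a level-`(N+1)`
Σ^max-modification is obtained by gluing level-`N` ν-modifications for `ν ∈ S` ONLY — which is
why the ν-wise form (CJS Def. 6.14, lead's `stub_nuEliminationsExist`) transfers across levels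
while the glued form (Def. 6.15; the tree fact `CossartJannsenSaito2020_sigmaMaxElimination`,
pinned at `N = 2`) does NOT: for `dim X ≤ 2` at levels `N ≠ 2` the crux is not literally an
instance of that fact (at `N = 1` the level-2 elimination can leave a level-1-maximal point
untouched, violating (ME2) — the curve `C₁ ⊔ C₂` of `hsMaxLocus_succ_subset`; at `N ≥ 3` its
centres over `X_max(2) ∖ X_max(N)` can violate (ME1)). [cite: CossartJannsenSaito2020, Rem. 2.29 (b), Def. 6.14] -/
theorem maximal_of_maximal_psum_succ {X : Scheme.{0}} [IsLocallyNoetherian X] {N : ℕ}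
    (hdim : topologicalKrullDim X ≤ (N : WithBot ℕ∞)) {ν : ℕ → ℕ} (hν : ν ∈ Scheme.hsValues X N)
    (hmax : Maximal (· ∈ Scheme.hsValues X (N + 1)) (psum ν)) :
    Maximal (· ∈ Scheme.hsValues X N) ν := by
  refine ⟨hν, ?_⟩
  rintro _ ⟨y, rfl⟩ hνy
  have h1 : psum ν ≤ Scheme.hsFun X (N + 1) y := by
    rw [hsFun_succ y (hsPsi_le_of_dim_le hdim y)]
    exact psum_mono hνy
  have h2 : Scheme.hsFun X (N + 1) y ≤ psum ν := hmax.2 ⟨y, rfl⟩ h1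
  have heq : Scheme.hsFun X (N + 1) y = psum ν := le_antisymm h2 h1
  rw [hsFun_succ y (hsPsi_le_of_dim_le hdim y)] at heq
  rw [psum_injective heq]

/-! ## §5 What a counterexample must be -/

/-- **Shape of a disproof.** `¬ SigmaMaxModifications` is the existence of ONE reduced separated
finite-type `X / k` (`char k = p` prime), not regular, and ONE level `N ≥ dim X`, such that NO
proper `π : X' → X` satisfies the seven clauses — in particular (by §1–§2) every proper
birational modification of `X` that is an isomorphism off `X_max(N)` and `H^N`-non-increasing
leaves a NEAR POINT (`H^N_{X'}(x') = H^N_X(x)`, `x ∈ X_max`) alive. Nothing of the kind is known: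
the catalogued specimens (Hironaka's quadric `x² + λy² + μz² + λμw²` over `𝔽₂(λ, μ)` —
barrier `DirectrixSmallCharacteristic`; Hauser–Perlega's kangaroo surfaces; Moh's
`p^{e-1}`-jump; Cossart–Piltant Rem. 3.2 `Z^p + u₄u₁^p + u₃u₂^p`) defeat particular INVARIANTS or
STRATEGIES (CJS Rem. 6.29, obstructions O1/O2), not the existence of a Σ^max-modification: each
of them is resolved in print (dimension `≤ 3`: Cossart–Piltant 2019) — though NOT by
modifications known to be isomorphisms off `X_max` (CP2019 §1), which is why even `dim X = 3` is
open for this crux. A refutation would be a new theorem of the field. [cite: CossartPiltant2019, §1] -/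
theorem not_sigmaMaxModifications_iff :
    ¬ SigmaMaxModifications ↔
      ∃ (p : ℕ) (_ : p.Prime) (k : Type) (_ : Field k) (_ : CharP k p) (X : Scheme.{0})
        (f : X ⟶ Spec (.of k)), IsSeparated f ∧ LocallyOfFiniteType f ∧ QuasiCompact f ∧
        IsReduced X ∧ ¬ Scheme.IsRegular X ∧ ∃ N : ℕ, topologicalKrullDim X ≤ (N : WithBot ℕ∞) ∧
          ∀ (X' : Scheme.{0}) (π : X' ⟶ X), ¬ IsWitness N X X' π := by
  rw [sigmaMaxModifications_iff]
  constructor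
  · intro h
    by_contra hcon
    apply h
    intro p hp k _ _ X f hs hl hq hr hreg N hN
    by_contra hX
    push Not at hX
    exact hcon ⟨p, hp, k, inferInstance, inferInstance, X, f, hs, hl, hq, hr, hreg, N, hN,
      fun X' π => hX X' π⟩
  · rintro ⟨p, hp, k, _, _, X, f, hs, hl, hq, hr, hreg, N, hN, hno⟩ h
    obtain ⟨X', π, hw⟩ := h p hp k X f hs hl hq hr hreg N hN
    exact hno X' π hw

/-- A disproof of the crux does NOT refute the summit: the crux is STRONGER than resolution
(route item `ModificationsResolve`, CJS Cor. 6.18, is `crux → summit`), and a resolution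
`π : X̃ → X` is in general NOT a Σ^max-modification — it is an isomorphism over `Reg X` only,
not over the non-maximal singular strata (ME1). Recorded as the trivial direction: a witness
whose source happens to be regular is a weak resolution. [cite: CossartJannsenSaito2020, Cor. 6.18] -/
theorem isResolution_of_isWitness_of_isRegular {N : ℕ} {X X' : Scheme.{0}} {π : X' ⟶ X}
    (hw : IsWitness N X X' π) (hreg : Scheme.IsRegular X')
    (hdense : Dense (Scheme.hsMaxLocus X N)ᶜ) (hopen : IsOpen (Scheme.hsMaxLocus X N)ᶜ) :
    IsResolution π := by
  obtain ⟨h1, -, -, hME1, h5, -, -⟩ := hw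
  refine ⟨h1, ⟨⟨_, hopen⟩, hdense, ?_, hME1 ⟨_, hopen⟩ le_rfl⟩, hreg⟩
  exact h5

/-! ## §6 Natural strengthenings -/

/-- **"Every sequence of permissible blow-ups with centres inside `X_max` terminates" is FALSE
in print, in every characteristic** (Spivakovsky 1989; the variant printed as Hauser 1998,
Example 2, verified here): for the threefold `X = V(f) ⊂ 𝔸⁴`, `f = x³ + yz²w⁴ + yz⁴w²`, the
Hilbert–Samuel (= multiplicity-`3`) locus is the union of the `y`-, `z`-, `w`-axes (orders
along the axes `0, 3, 3, 3`, `compute/spivakovsky_cycle.py`); blowing up the `w`-axis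
`V(x,y,z)` (permissible: order `3` all along it) gives in the `y`-chart `x ↦ xy, z ↦ zy` the
strict transform `f' = x³ + z²w⁴ + y²z⁴w²` (axis orders `0, 3, 3, 2`); blowing up the `z`-axis
`V(x,y,w)` of `X' = V(f')` (permissible) gives back `f` in the `y`-chart `x ↦ xy, w ↦ wy` — a
CYCLE of length two of permissible blow-ups inside `X_max` along which the maximal value
survives forever, so no finite piece of the sequence satisfies (ME2). Consequences: (i) a
ν-elimination (lead's `stub_nuEliminationsExist`) must CHOOSE its centres — "any permissible
centre of maximal dimension in `X(ν)`" loops (CJS Rem. 6.29 blows up the singular point of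
`X_max` first and labels old/new components, which is Hauser's "second answer" to exactly this
example); (ii) the crux itself survives (it asks for SOME Σ^max-modification: in characteristic
`0` one exists by Hironaka; in characteristic `3`, where `f = x³ + g` is purely inseparable,
its existence is precisely the open question, although `X` is resolved by Cossart–Piltant
2019) — a new test specimen for the route's CHEAPEST FALSIFIER list. Recorded as the two chart
identities, the algebraic content of the cycle. [cite: Hauser1998, Example 2; Spivakovsky1989] -/
theorem spivakovsky_hauser_cycle {R : Type*} [CommRing R] (x y z w : R) :
    ((x * y) ^ 3 + y * (z * y) ^ 2 * w ^ 4 + y * (z * y) ^ 4 * w ^ 2 =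
        y ^ 3 * (x ^ 3 + z ^ 2 * w ^ 4 + y ^ 2 * z ^ 4 * w ^ 2)) ∧
      ((x * y) ^ 3 + z ^ 2 * (w * y) ^ 4 + y ^ 2 * z ^ 4 * (w * y) ^ 2 =
        y ^ 3 * (x ^ 3 + y * z ^ 2 * w ^ 4 + y * z ^ 4 * w ^ 2)) :=
  ⟨by ring, by ring⟩

/-! ### Other natural strengthenings (informal; each with its obstruction)

* "`π` FINITE" — false from dimension `2`: at a NORMAL non-regular point (cone over a smooth
  plane cubic, `E₈`, …) every finite birational modification from a reduced scheme with dense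
  preimage is an isomorphism near the point, so (ME2) fails; in dimension `1` it is true
  (partial normalisation at `X_max`, values drop to `Φ`). Ideator k1's B1 adds: normalisation
  also violates (ME1) (it modifies the non-normal NON-maximal points) and can RAISE `H(1)`.
* "ONE permissible blow-up suffices" — false: the tacnode `y² = x⁴ ⊂ 𝔸²_{𝔽_p}` (`p ≠ 2`)
  has `X_max = {0}` with value `(1,2,2,…)`; the only permissible centre inside `X_max` is the
  point, and its blow-up has a near point (the node `y'² = x²` of the chart `y = y'x`) with the
  same value `(1,2,2,…)` (every double point of a plane curve has it). Eliminations are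
  SEQUENCES (CJS Def. 6.14).
* "`X'` REGULAR" (resolution that is an isomorphism off `X_max`) — unavailable whenever some
  point of `X_max` lies in the closure of `Sing X ∖ X_max` (Whitney-umbrella type strata):
  over such a point no modification that is an isomorphism off `X_max` can be regular
  (regularity is open on the excellent `X'` and `π` is a homeomorphism over `X ∖ X_max`).
  So the crux is genuinely an INTERMEDIATE statement: weaker than "resolve in one stroke off
  `X_max`", stronger than resolution.
* "strict drop EVERYWHERE" — absurd (`hsFun_eq_of_ME1`).
* "same `π` for all `N`" — not implied in either direction (§4).
-/

/-! ## §7 Targets (lead's stubs)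

No skeleton is registered at this cycle (`ledger crux ls`: PICKED.md only). PICKED.md announces
`stub_nuEliminationsExist` (open core: ν-eliminations as blow-up sequences, CJS Def. 6.14),
`stub_centreSeq_package`, `stub_sigmaMaxModification_of_nuModifications` (glue Def. 6.14 →
6.15) and `SigmaMaxModifications_of`. Paper check of the GLUE (to be re-done in Lean on the
registered signatures): composing ν₁-, …, ν_r-modifications sequentially is sound — after a
ν₁-modification `X₁ → X` (iso off `X(ν₁)`, monotone, `ν₁ ∉ Σ_{X₁}`), `ν₂` is still attained on
`X₁` (over `X(ν₂) ⊆ X ∖ X(ν₁)`, where nothing changed) and still MAXIMAL in `Σ_{X₁}` (new values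
are `≤ ν₁`, and `ν₂ < μ ≤ ν₁` would contradict maximality of `ν₂`), and `ν₁` cannot reappear
later (a value `< ν₂` equal to `ν₁` would give `ν₁ < ν₂`). Two things the glue must NOT assume:
(i) that `X₁(ν₂) = X(ν₂)` as SETS is closed/open compatible with the typed (ME1) ("every open
inside the complement") — fine since `X(ν₂)` misses the modified locus; (ii) that the maximal
values of `Σ_{X₁}` are only the surviving `ν_i` — FALSE in general (new maximal values `< ν₁`
may appear over `X(ν₁)`), but (ME2) only concerns `Σ_X^max`, so the glue survives. The weak
point to probe when the skeleton lands: whether `stub_nuEliminationsExist` asks monotonicity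
END-TO-END or STAGEWISE, and at which level `N` the ν-stratum is taken (§4: strata are
level-dependent).
-/

end Summit.ResolutionOfSingularities.ResolutionOfSingularities.Cruxes.SigmaMaxModifications.Disproof

end
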